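import Literature.NumberTheory.PAdicHodge.KatoH1BdRFilHolds
import Literature.NumberTheory.PAdicHodge.DualExpElliptic
import Literature.NumberTheory.EllipticCurves.TateModuleContinuityProofs
import HarnessLib

/-!
# `HasDualExp` for INTEGRAL cocycles `η : Γ_F → T_pW` from de Rhamness (adapter for the capstone `TatePairingPointOfKTwo`)

Topic `Literature/NumberTheory/PAdicHodge`; THEOREMS ONLY (no definition, no named fact, no instance, no `sorry`). The tree proves Kato II
Prop. 1.2.3 (`cupLogInjective_and_hasDualExp_of_isDeRham_holds`) for continuous cocycles of the RATIONAL representation `V_pW|_{Γ_F}`; the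
capstone of line `kato_lever` (`exists_const_tatePairingPoint_eq_neg_trace_of_KTwo`) asks for `HasDualExp` of `σ ↦ 1 ⊗ η(σ)` for
INTEGRAL cocycles `η` of `T_pW|_{Γ_F}`. This file packages `σ ↦ 1 ⊗ η(σ)` as a continuous cocycle of `V_pW|_{Γ_F}`
(`TateModule.continuous_toRational`) and reads off both binders from de Rhamness:

★ `cupLogInjective_and_hasDualExp_toRational_of_isDeRham` — `IsDeRham(V_pW|_{Γ_F}) ⟹ CupLogInjective ∧ ∀ η, HasDualExp (σ ↦ 1 ⊗ η σ)`.

Crux K★ `stmt-BirchSwinnertonDyer-22226`; BSD / K★ are NOT proved by this file.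

## References
* K. Kato, LNM 1553 (1993), Ch. II Prop. 1.2.3, Ex. 1.3.5. [Kato1993LNM1553]
-/

noncomputable section

open Field Function ValuativeRel WittVector

namespace Literature.NumberTheory.PAdicHodge

open Literature.NumberTheory.GaloisRepresentations
open Literature.NumberTheory.GaloisRepresentations.IsNonarchimedeanLocalField
open Literature.NumberTheory.EllipticCurves
open _root_.WeierstrassCurve

variable {F : Type} [Field F] [ValuativeRel F] [TopologicalSpace F] [IsNonarchimedeanLocalField F] [CharZero F]
  {p : ℕ} [Fact p.Prime] [Fact (¬ IsUnit (p : integerC F))] [IsAdicComplete (Ideal.span {(p : integerC F)}) (integerC F)]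
  (hp : valuation F p < 1) [Algebra ℚ_[p] F]
  {K₀ : Type} [Field K₀] [Algebra K₀ F] (W : WeierstrassCurve K₀) [W.IsElliptic]

/-- ★ **Prop. 1.2.3 for integral cocycles**: if `V_pW|_{Γ_F}` is de Rham then `x ↦ x ∪ log χ` is injective on `Fil⁰ D_dR` and every
INTEGRAL continuous cocycle `η : Γ_F → T_pW` has a dual exponential for `σ ↦ 1 ⊗ η(σ)` — the hypotheses `hinj`, `hde` of
`TatePairingPointOfKTwo.exists_const_tatePairingPoint_eq_neg_trace_of_KTwo`. [cite: Kato1993LNM1553, Ch. II Prop. 1.2.3 and Ex. 1.3.5] -/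
theorem cupLogInjective_and_hasDualExp_toRational_of_isDeRham
    [IsTopologicalAddGroup (W.rationalTateModule p)] [ContinuousSMul ℚ_[p] (W.rationalTateModule p)]
    [Module.Finite ℚ_[p] (W.rationalTateModule p)] [IsModuleTopology ℚ_[p] (W.rationalTateModule p)]
    (hDR : GaloisRep.IsDeRham (bdRPeriodRingData (F := F) (p := p) hp) (restrictedRationalTateRep W F p)) :
    (bdRPeriodRingData (F := F) (p := p) hp).CupLogInjective (logCyclotomic p) (restrictedRationalTateRep W F p) ∧
      ∀ η : contOneCocycles (restrictedTateRep W F p).toTopRep,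
        (bdRPeriodRingData (F := F) (p := p) hp).HasDualExp (logCyclotomic p) (restrictedRationalTateRep W F p)
          fun σ => TateModule.toRational p (η.1 σ) := by
  obtain ⟨hinj, hde⟩ := cupLogInjective_and_hasDualExp_of_isDeRham_holds hp (restrictedRationalTateRep W F p) hDR
  refine ⟨hinj, fun η => ?_⟩
  haveI := module_finite_tateModule_holds W p
  -- `σ ↦ 1 ⊗ η(σ)` as a continuous cocycle of the rational representation
  let z : contOneCocycles (restrictedRationalTateRep W F p).toTopRep :=
    ⟨⟨fun σ => TateModule.toRational p (η.1 σ), (TateModule.continuous_toRational (A := geomPoints W) (p := p)).comp η.1.continuous⟩,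
      fun g h => by
        change TateModule.toRational p (η.1 (g * h)) =
          TateModule.toRational p (η.1 g) + restrictedRationalTateRep W F p g (TateModule.toRational p (η.1 h))
        rw [η.2 g h, map_add, restrictedRationalTateRep_toRational]
        rfl⟩
  exact hde z

end Literature.NumberTheory.PAdicHodge

end
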